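import Mathlib.Combinatorics.SimpleGraph.Basic
import Mathlib.Data.Finset.Lattice.Fold
import Mathlib.Data.Fintype.Powerset
import HarnessLib

/-!
# The closure operator of a linearly ordered graph (Conneryd–Ghannane–Pang 2025, Def. 6.6,
# after [CdRNPR25]) and closure operators from intersection-stable families

Topic `Literature/ModelTheory/FiniteModelTheory`.  Part of the bottom-up formalisation of the
named fact `connerydGhannanePang2025_thm_6_1` (arXiv:2511.17272, Thm. 6.1); this file supplies the
closure map `cl` fed to `graphCohomologicallyKConsistent_of_reducible`
(`CohomologicalConsistencyIdealReduction.lean`), with the closure-operator axioms of Def. 4.1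
PROVED for all sets.

## Source, as printed (arXiv:2511.17272 §6, before Def. 6.6)

Fix a graph `G = (V,E)` with a linear order `≺` on `V`.  A decreasing path is a simple path
`(v_1,…,v_τ)` with `v_i ≻ v_{i+1}`; `v` is a DESCENDANT of `u` if there is a decreasing path from
`u` to `v`; `Desc(U)` is the set of descendants of `U` (`U ⊆ Desc(U)`).  "A `τ`-hop with respect
to a set `U ⊆ V` is a simple path or a simple cycle of length `τ` with the property that its two
endpoints are both contained in `U` (in the case of cycles, the two endpoints coincide), while
all other vertices are not in `U`.  A lasso with respect to `U` is a walk `(v_1, v_2, v_3, v_4, v_5)`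
where `v_2 = v_5` and all other vertices are distinct, and where `v_1 ∈ U`."
**Definition 6.6 (Closure).** `U` is CLOSED if `U = Desc(U)` and there are no `2`-, `3`-, `4`-hops
or lassos with respect to `U`.  A closure of `U` is any minimal closed set containing `U`; "there
is in fact a unique closure for every set `U`" [CdRNPR25], denoted `cl(U)`, and `cl` is a closure
operator (self-containment, monotonicity, idempotence).

## Rendering

* `U = Desc(U)` ⇔ `U` is closed under single decreasing edges (`IsDescClosed`: `u ∈ U`,
  `v ~ u`, `v < u` ⇒ `v ∈ U`), by induction along decreasing paths.
* Hops of length `2, 3, 4` are spelled out as vertex tuples (`HasHop2`, `HasHop3Path`,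
  `HasHop3Cycle`, `HasHop4Path`, `HasHop4Cycle`): consecutive vertices adjacent, endpoints in `U`,
  inner vertices outside `U`, and the simplicity constraints not already forced by adjacency /
  membership (`a ≠ c` for paths, `b₁ ≠ b₃` for the `4`-cycle; a `2`-cycle does not exist).
* Lassos (`HasLasso`): `v_1 ∈ U`, `v_1 ~ v_2 ~ v_3 ~ v_4 ~ v_2`, with `v_2, v_3, v_4 ∉ U`.  READING:
  the printed sentence only says "`v_1 ∈ U`"; we read the lasso condition like the hop condition
  ("all other vertices are not in `U`"), since with `v_2, v_3, v_4` unrestricted no set containing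
  a triangle with a pendant edge — in particular `V` itself — would be closed, contradicting the
  existence of closures of all sets asserted in the source.  (To be confirmed against [CdRNPR25].)
* `IsClosed G U` is Definition 6.6.  KEY LEMMA (implicit in "unique closure"): closed sets are
  stable under INTERSECTION (`IsClosed.inter`, a case analysis: a hop / lasso w.r.t. `U₁ ∩ U₂`
  contains a shorter hop or a lasso w.r.t. `U₁` or `U₂`) and `V` is closed (`isClosed_univ`).
* Hence (generic part, any intersection-stable family containing `univ`: `closureOf`) the closure
  `cl U := ⋂ {W ⊇ U closed}` is the least closed superset (`subset_closureOf`,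
  `isClosed_closureOf`, `closureOf_subset`), so closures are unique, and `cl` is a closure
  operator on ALL subsets: `closureOf_mono`, `closureOf_closureOf` (Def. 4.1).

NOT here: the size bound Lemma 6.7 (= [CdRNPR25, Lemma 5.4]) and reducibility Lemma 6.8
(= [CdRNPR25, Lemma 6.5]); their proofs are in [CdRNPR25], not in the source.

## References

* [ConnerydGhannanePang2025] arXiv:2511.17272 §6, Def. 6.6 and the paragraph before it;
  Def. 4.1. READ.
* [CdRNPR25] J. Conneryd, S. F. de Rezende, J. Nordström, S. Pang, K. Risse, Graph Colouring Is
  Hard on Average for Polynomial Calculus and Nullstellensatz, FOCS 2023 (cited via the source;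
  not held).
-/

namespace Literature.ModelTheory.FiniteModelTheory

namespace ConnerydGhannanePang

open Finset

/-! ### Closure operators from intersection-stable families of finite sets -/

section Generic

variable {V : Type*} [Fintype V] [DecidableEq V] (Closed : Finset V → Prop) [DecidablePred Closed]

/-- The CLOSURE of `U` for a family `Closed` of finite sets: the intersection of all closed
supersets of `U` (all of `V` if there is none). [cite: ConnerydGhannanePang2025, Def. 6.6] -/
def closureOf (U : Finset V) : Finset V :=
  ((Finset.univ : Finset (Finset V)).filter fun W => U ⊆ W ∧ Closed W).inf id

/-- Self-containment: `U ⊆ cl(U)`. [cite: ConnerydGhannanePang2025, Def. 4.1] -/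
theorem subset_closureOf (U : Finset V) : U ⊆ closureOf Closed U :=
  Finset.le_inf fun _ hW => (Finset.mem_filter.1 hW).2.1

/-- `cl(U)` lies inside every closed superset of `U`. [cite: ConnerydGhannanePang2025, Def. 6.6] -/
theorem closureOf_subset {U W : Finset V} (hUW : U ⊆ W) (hW : Closed W) : closureOf Closed U ⊆ W :=
  Finset.inf_le (f := id) (Finset.mem_filter.2 ⟨Finset.mem_univ W, hUW, hW⟩)

variable {Closed}

/-- For an intersection-stable family containing `univ`, `cl(U)` is closed — so it is THE least
closed superset of `U` (closures are unique). [cite: ConnerydGhannanePang2025, Def. 6.6] -/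
theorem isClosed_closureOf (huniv : Closed Finset.univ)
    (hinter : ∀ A B : Finset V, Closed A → Closed B → Closed (A ∩ B)) (U : Finset V) :
    Closed (closureOf Closed U) :=
  Finset.inf_induction (p := Closed) huniv (fun A hA B hB => hinter A B hA hB)
    fun _ hW => (Finset.mem_filter.1 hW).2.2

/-- Uniqueness of closures: a minimal closed superset of `U` is `cl(U)`.
[cite: ConnerydGhannanePang2025, Def. 6.6 ("there is in fact a unique closure")] -/
theorem eq_closureOf_of_minimal (huniv : Closed Finset.univ)
    (hinter : ∀ A B : Finset V, Closed A → Closed B → Closed (A ∩ B)) {U W : Finset V}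
    (hUW : U ⊆ W) (hW : Closed W) (hmin : ∀ W', U ⊆ W' → Closed W' → W' ⊆ W → W' = W) :
    W = closureOf Closed U :=
  (hmin _ (subset_closureOf Closed U) (isClosed_closureOf huniv hinter U)
    (closureOf_subset Closed hUW hW)).symm

/-- Closed sets are their own closure. [folklore] -/
theorem closureOf_eq_self {U : Finset V} (hU : Closed U) : closureOf Closed U = U :=
  Finset.Subset.antisymm (closureOf_subset Closed Finset.Subset.rfl hU) (subset_closureOf Closed U)

/-- Monotonicity: `U ⊆ U'` implies `cl(U) ⊆ cl(U')`. [cite: ConnerydGhannanePang2025, Def. 4.1] -/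
theorem closureOf_mono (huniv : Closed Finset.univ)
    (hinter : ∀ A B : Finset V, Closed A → Closed B → Closed (A ∩ B)) {U U' : Finset V}
    (h : U ⊆ U') : closureOf Closed U ⊆ closureOf Closed U' :=
  closureOf_subset Closed (h.trans (subset_closureOf Closed U')) (isClosed_closureOf huniv hinter U')

/-- Idempotence: `cl(cl(U)) = cl(U)`. [cite: ConnerydGhannanePang2025, Def. 4.1] -/
theorem closureOf_closureOf (huniv : Closed Finset.univ)
    (hinter : ∀ A B : Finset V, Closed A → Closed B → Closed (A ∩ B)) (U : Finset V) :
    closureOf Closed (closureOf Closed U) = closureOf Closed U :=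
  Finset.Subset.antisymm
    (closureOf_subset Closed Finset.Subset.rfl (isClosed_closureOf huniv hinter U))
    (subset_closureOf Closed _)

end Generic

/-! ### Definition 6.6: closed vertex sets of a linearly ordered graph -/

section Graph

variable {V : Type*} (G : SimpleGraph V)

/-- `U = Desc(U)`: `U` is closed under decreasing edges (equivalently under decreasing paths).
[cite: ConnerydGhannanePang2025, Def. 6.6] -/
def IsDescClosed [LT V] (U : Finset V) : Prop :=
  ∀ ⦃u : V⦄, u ∈ U → ∀ ⦃v : V⦄, G.Adj u v → v < u → v ∈ U

/-- A `2`-HOP w.r.t. `U`: a path `a ~ b ~ c` with `a ≠ c` in `U` and `b ∉ U`.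
[cite: ConnerydGhannanePang2025, §6 (hops)] -/
def HasHop2 (U : Finset V) : Prop :=
  ∃ a b c : V, a ∈ U ∧ c ∈ U ∧ b ∉ U ∧ a ≠ c ∧ G.Adj a b ∧ G.Adj b c

/-- A `3`-HOP PATH w.r.t. `U`: `a ~ b₁ ~ b₂ ~ c`, `a ≠ c` in `U`, `b₁, b₂ ∉ U`.
[cite: ConnerydGhannanePang2025, §6 (hops)] -/
def HasHop3Path (U : Finset V) : Prop :=
  ∃ a b₁ b₂ c : V, a ∈ U ∧ c ∈ U ∧ b₁ ∉ U ∧ b₂ ∉ U ∧ a ≠ c ∧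
    G.Adj a b₁ ∧ G.Adj b₁ b₂ ∧ G.Adj b₂ c

/-- A `3`-HOP CYCLE w.r.t. `U`: a triangle `a ~ b₁ ~ b₂ ~ a` with `a ∈ U`, `b₁, b₂ ∉ U`.
[cite: ConnerydGhannanePang2025, §6 (hops)] -/
def HasHop3Cycle (U : Finset V) : Prop :=
  ∃ a b₁ b₂ : V, a ∈ U ∧ b₁ ∉ U ∧ b₂ ∉ U ∧ G.Adj a b₁ ∧ G.Adj b₁ b₂ ∧ G.Adj b₂ a

/-- A `4`-HOP PATH w.r.t. `U`: `a ~ b₁ ~ b₂ ~ b₃ ~ c` simple, `a ≠ c` in `U`, `bᵢ ∉ U`.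
[cite: ConnerydGhannanePang2025, §6 (hops)] -/
def HasHop4Path (U : Finset V) : Prop :=
  ∃ a b₁ b₂ b₃ c : V, a ∈ U ∧ c ∈ U ∧ b₁ ∉ U ∧ b₂ ∉ U ∧ b₃ ∉ U ∧ a ≠ c ∧ b₁ ≠ b₃ ∧
    G.Adj a b₁ ∧ G.Adj b₁ b₂ ∧ G.Adj b₂ b₃ ∧ G.Adj b₃ c

/-- A `4`-HOP CYCLE w.r.t. `U`: a `4`-cycle `a ~ b₁ ~ b₂ ~ b₃ ~ a` (`b₁ ≠ b₃`) with `a ∈ U`,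
`bᵢ ∉ U`. [cite: ConnerydGhannanePang2025, §6 (hops)] -/
def HasHop4Cycle (U : Finset V) : Prop :=
  ∃ a b₁ b₂ b₃ : V, a ∈ U ∧ b₁ ∉ U ∧ b₂ ∉ U ∧ b₃ ∉ U ∧ b₁ ≠ b₃ ∧
    G.Adj a b₁ ∧ G.Adj b₁ b₂ ∧ G.Adj b₂ b₃ ∧ G.Adj b₃ a

/-- A LASSO w.r.t. `U`: `v₁ ~ v₂ ~ v₃ ~ v₄ ~ v₂` with `v₁ ∈ U` and (our reading, see the module
docstring) `v₂, v₃, v₄ ∉ U`. [cite: ConnerydGhannanePang2025, §6 (lassos)] -/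
def HasLasso (U : Finset V) : Prop :=
  ∃ v₁ v₂ v₃ v₄ : V, v₁ ∈ U ∧ v₂ ∉ U ∧ v₃ ∉ U ∧ v₄ ∉ U ∧
    G.Adj v₁ v₂ ∧ G.Adj v₂ v₃ ∧ G.Adj v₃ v₄ ∧ G.Adj v₄ v₂

/-- **Definition 6.6 (closed set)**: descendant-closed, no `2`-, `3`-, `4`-hops and no lassos.
[cite: ConnerydGhannanePang2025, Def. 6.6] -/
structure IsClosed [LT V] (U : Finset V) : Prop where
  desc : IsDescClosed G U
  hop2 : ¬ HasHop2 G U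
  hop3Path : ¬ HasHop3Path G U
  hop3Cycle : ¬ HasHop3Cycle G U
  hop4Path : ¬ HasHop4Path G U
  hop4Cycle : ¬ HasHop4Cycle G U
  lasso : ¬ HasLasso G U

variable {G}

/-- The whole vertex set is closed. [folklore] -/
theorem isClosed_univ [LT V] [Fintype V] : IsClosed G (Finset.univ : Finset V) where
  desc := fun _ _ v _ _ => Finset.mem_univ v
  hop2 := fun ⟨_, b, _, _, _, hb, _⟩ => hb (Finset.mem_univ b)
  hop3Path := fun ⟨_, b, _, _, _, _, hb, _⟩ => hb (Finset.mem_univ b)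
  hop3Cycle := fun ⟨_, b, _, _, hb, _⟩ => hb (Finset.mem_univ b)
  hop4Path := fun ⟨_, b, _, _, _, _, _, hb, _⟩ => hb (Finset.mem_univ b)
  hop4Cycle := fun ⟨_, b, _, _, _, hb, _⟩ => hb (Finset.mem_univ b)
  lasso := fun ⟨_, b, _, _, _, hb, _⟩ => hb (Finset.mem_univ b)

section Inter

variable [LT V]

/-- No `2`-hop, applied form. [folklore] -/
theorem IsClosed.no_hop2 {U : Finset V} (h : IsClosed G U) {a b c : V} (ha : a ∈ U) (hc : c ∈ U)
    (hb : b ∉ U) (hac : a ≠ c) (h₁ : G.Adj a b) (h₂ : G.Adj b c) : False :=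
  h.hop2 ⟨a, b, c, ha, hc, hb, hac, h₁, h₂⟩

/-- No `3`-hop path, applied form. [folklore] -/
theorem IsClosed.no_hop3Path {U : Finset V} (h : IsClosed G U) {a b₁ b₂ c : V} (ha : a ∈ U)
    (hc : c ∈ U) (hb₁ : b₁ ∉ U) (hb₂ : b₂ ∉ U) (hac : a ≠ c) (h₁ : G.Adj a b₁) (h₂ : G.Adj b₁ b₂)
    (h₃ : G.Adj b₂ c) : False :=
  h.hop3Path ⟨a, b₁, b₂, c, ha, hc, hb₁, hb₂, hac, h₁, h₂, h₃⟩

/-- No `3`-hop cycle, applied form. [folklore] -/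
theorem IsClosed.no_hop3Cycle {U : Finset V} (h : IsClosed G U) {a b₁ b₂ : V} (ha : a ∈ U)
    (hb₁ : b₁ ∉ U) (hb₂ : b₂ ∉ U) (h₁ : G.Adj a b₁) (h₂ : G.Adj b₁ b₂) (h₃ : G.Adj b₂ a) : False :=
  h.hop3Cycle ⟨a, b₁, b₂, ha, hb₁, hb₂, h₁, h₂, h₃⟩

omit [LT V] in
/-- Members of `U₂` differ from non-members of `U₂`. [folklore] -/
theorem ne_of_mem_of_notMem' {U₂ : Finset V} {x y : V} (hx : x ∈ U₂) (hy : y ∉ U₂) : x ≠ y :=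
  fun h => hy (h ▸ hx)

variable [DecidableEq V] {U₁ U₂ : Finset V}

omit [LT V] in
/-- Elements of `U₁ ∖ (U₁ ∩ U₂)` are outside `U₂`. [folklore] -/
theorem notMem_of_mem_of_notMem_inter {x : V} (h₁ : x ∈ U₁) (h : x ∉ U₁ ∩ U₂) : x ∉ U₂ :=
  fun h₂ => h (Finset.mem_inter.2 ⟨h₁, h₂⟩)

/-- **Closed sets are stable under intersection** (the fact behind "unique closure"): a hop or
lasso with respect to `U₁ ∩ U₂` contains a (shorter) hop or a lasso with respect to `U₁` or `U₂`.
[cite: ConnerydGhannanePang2025, Def. 6.6] -/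
theorem IsClosed.inter (h₁ : IsClosed G U₁) (h₂ : IsClosed G U₂) : IsClosed G (U₁ ∩ U₂) where
  desc := fun u hu v huv hvu =>
    Finset.mem_inter.2 ⟨h₁.desc (Finset.mem_inter.1 hu).1 huv hvu,
      h₂.desc (Finset.mem_inter.1 hu).2 huv hvu⟩
  hop2 := by
    rintro ⟨a, b, c, ha, hc, hb, hac, e₁, e₂⟩
    rw [Finset.mem_inter] at ha hc
    by_cases hb₁ : b ∈ U₁
    · exact h₂.no_hop2 ha.2 hc.2 (notMem_of_mem_of_notMem_inter hb₁ hb) hac e₁ e₂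
    · exact h₁.no_hop2 ha.1 hc.1 hb₁ hac e₁ e₂
  hop3Path := by
    rintro ⟨a, b₁, b₂, c, ha, hc, hb₁, hb₂, hac, e₁, e₂, e₃⟩
    rw [Finset.mem_inter] at ha hc
    by_cases k₁ : b₁ ∈ U₁ <;> by_cases k₂ : b₂ ∈ U₁
    · exact h₂.no_hop3Path ha.2 hc.2 (notMem_of_mem_of_notMem_inter k₁ hb₁)
        (notMem_of_mem_of_notMem_inter k₂ hb₂) hac e₁ e₂ e₃
    · exact h₁.no_hop2 k₁ hc.1 k₂
        (ne_of_mem_of_notMem' hc.2 (notMem_of_mem_of_notMem_inter k₁ hb₁)).symm e₂ e₃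
    · exact h₁.no_hop2 ha.1 k₂ k₁
        (ne_of_mem_of_notMem' ha.2 (notMem_of_mem_of_notMem_inter k₂ hb₂)) e₁ e₂
    · exact h₁.no_hop3Path ha.1 hc.1 k₁ k₂ hac e₁ e₂ e₃
  hop3Cycle := by
    rintro ⟨a, b₁, b₂, ha, hb₁, hb₂, e₁, e₂, e₃⟩
    rw [Finset.mem_inter] at ha
    by_cases k₁ : b₁ ∈ U₁ <;> by_cases k₂ : b₂ ∈ U₁
    · exact h₂.no_hop3Cycle ha.2 (notMem_of_mem_of_notMem_inter k₁ hb₁)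
        (notMem_of_mem_of_notMem_inter k₂ hb₂) e₁ e₂ e₃
    · exact h₁.no_hop2 k₁ ha.1 k₂
        (ne_of_mem_of_notMem' ha.2 (notMem_of_mem_of_notMem_inter k₁ hb₁)).symm e₂ e₃
    · exact h₁.no_hop2 ha.1 k₂ k₁
        (ne_of_mem_of_notMem' ha.2 (notMem_of_mem_of_notMem_inter k₂ hb₂)) e₁ e₂
    · exact h₁.no_hop3Cycle ha.1 k₁ k₂ e₁ e₂ e₃
  hop4Path := by
    rintro ⟨a, b₁, b₂, b₃, c, ha, hc, hb₁, hb₂, hb₃, hac, h13, e₁, e₂, e₃, e₄⟩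
    rw [Finset.mem_inter] at ha hc
    by_cases k₁ : b₁ ∈ U₁ <;> by_cases k₂ : b₂ ∈ U₁ <;> by_cases k₃ : b₃ ∈ U₁
    · exact h₂.hop4Path ⟨a, b₁, b₂, b₃, c, ha.2, hc.2, notMem_of_mem_of_notMem_inter k₁ hb₁,
        notMem_of_mem_of_notMem_inter k₂ hb₂, notMem_of_mem_of_notMem_inter k₃ hb₃, hac, h13,
        e₁, e₂, e₃, e₄⟩
    · exact h₁.no_hop2 k₂ hc.1 k₃
        (ne_of_mem_of_notMem' hc.2 (notMem_of_mem_of_notMem_inter k₂ hb₂)).symm e₃ e₄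
    · exact h₁.no_hop2 k₁ k₃ k₂ h13 e₂ e₃
    · exact h₁.no_hop3Path k₁ hc.1 k₂ k₃
        (ne_of_mem_of_notMem' hc.2 (notMem_of_mem_of_notMem_inter k₁ hb₁)).symm e₂ e₃ e₄
    · exact h₁.no_hop2 ha.1 k₂ k₁
        (ne_of_mem_of_notMem' ha.2 (notMem_of_mem_of_notMem_inter k₂ hb₂)) e₁ e₂
    · exact h₁.no_hop2 ha.1 k₂ k₁
        (ne_of_mem_of_notMem' ha.2 (notMem_of_mem_of_notMem_inter k₂ hb₂)) e₁ e₂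
    · exact h₁.no_hop3Path ha.1 k₃ k₁ k₂
        (ne_of_mem_of_notMem' ha.2 (notMem_of_mem_of_notMem_inter k₃ hb₃)) e₁ e₂ e₃
    · exact h₁.hop4Path ⟨a, b₁, b₂, b₃, c, ha.1, hc.1, k₁, k₂, k₃, hac, h13, e₁, e₂, e₃, e₄⟩
  hop4Cycle := by
    rintro ⟨a, b₁, b₂, b₃, ha, hb₁, hb₂, hb₃, h13, e₁, e₂, e₃, e₄⟩
    rw [Finset.mem_inter] at ha
    by_cases k₁ : b₁ ∈ U₁ <;> by_cases k₂ : b₂ ∈ U₁ <;> by_cases k₃ : b₃ ∈ U₁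
    · exact h₂.hop4Cycle ⟨a, b₁, b₂, b₃, ha.2, notMem_of_mem_of_notMem_inter k₁ hb₁,
        notMem_of_mem_of_notMem_inter k₂ hb₂, notMem_of_mem_of_notMem_inter k₃ hb₃, h13,
        e₁, e₂, e₃, e₄⟩
    · exact h₁.no_hop2 k₂ ha.1 k₃
        (ne_of_mem_of_notMem' ha.2 (notMem_of_mem_of_notMem_inter k₂ hb₂)).symm e₃ e₄
    · exact h₁.no_hop2 k₁ k₃ k₂ h13 e₂ e₃
    · exact h₁.no_hop3Path k₁ ha.1 k₂ k₃
        (ne_of_mem_of_notMem' ha.2 (notMem_of_mem_of_notMem_inter k₁ hb₁)).symm e₂ e₃ e₄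
    · exact h₁.no_hop2 ha.1 k₂ k₁
        (ne_of_mem_of_notMem' ha.2 (notMem_of_mem_of_notMem_inter k₂ hb₂)) e₁ e₂
    · exact h₁.no_hop2 ha.1 k₂ k₁
        (ne_of_mem_of_notMem' ha.2 (notMem_of_mem_of_notMem_inter k₂ hb₂)) e₁ e₂
    · exact h₁.no_hop3Path ha.1 k₃ k₁ k₂
        (ne_of_mem_of_notMem' ha.2 (notMem_of_mem_of_notMem_inter k₃ hb₃)) e₁ e₂ e₃
    · exact h₁.hop4Cycle ⟨a, b₁, b₂, b₃, ha.1, k₁, k₂, k₃, h13, e₁, e₂, e₃, e₄⟩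
  lasso := by
    rintro ⟨v₁, v₂, v₃, v₄, hv₁, hv₂, hv₃, hv₄, e₁, e₂, e₃, e₄⟩
    rw [Finset.mem_inter] at hv₁
    by_cases k₂ : v₂ ∈ U₁ <;> by_cases k₃ : v₃ ∈ U₁ <;> by_cases k₄ : v₄ ∈ U₁
    · exact h₂.lasso ⟨v₁, v₂, v₃, v₄, hv₁.2, notMem_of_mem_of_notMem_inter k₂ hv₂,
        notMem_of_mem_of_notMem_inter k₃ hv₃, notMem_of_mem_of_notMem_inter k₄ hv₄,
        e₁, e₂, e₃, e₄⟩
    · exact h₁.no_hop2 k₃ k₂ k₄ (G.ne_of_adj e₂).symm e₃ e₄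
    · exact h₁.no_hop2 k₂ k₄ k₃ (G.ne_of_adj e₄).symm e₂ e₃
    · exact h₁.no_hop3Cycle k₂ k₃ k₄ e₂ e₃ e₄
    · exact h₁.no_hop2 hv₁.1 k₃ k₂
        (ne_of_mem_of_notMem' hv₁.2 (notMem_of_mem_of_notMem_inter k₃ hv₃)) e₁ e₂
    · exact h₁.no_hop2 hv₁.1 k₃ k₂
        (ne_of_mem_of_notMem' hv₁.2 (notMem_of_mem_of_notMem_inter k₃ hv₃)) e₁ e₂
    · exact h₁.no_hop2 hv₁.1 k₄ k₂
        (ne_of_mem_of_notMem' hv₁.2 (notMem_of_mem_of_notMem_inter k₄ hv₄)) e₁ e₄.symm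
    · exact h₁.lasso ⟨v₁, v₂, v₃, v₄, hv₁.1, k₂, k₃, k₄, e₁, e₂, e₃, e₄⟩

end Inter

/-! ### The closure operator `cl` -/

section Closure

variable [LT V] [Fintype V] [DecidableEq V]

variable (G)

/-- **The closure `cl(U)`** of Conneryd–Ghannane–Pang / [CdRNPR25]: the intersection of all
closed supersets, i.e. the unique minimal closed set containing `U`.
[cite: ConnerydGhannanePang2025, Def. 6.6] -/
noncomputable def cl (U : Finset V) : Finset V :=
  @closureOf V _ _ (IsClosed G) (fun W => Classical.dec (IsClosed G W)) U

variable {G}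

/-- `U ⊆ cl(U)`. [cite: ConnerydGhannanePang2025, Def. 4.1 (self-containment)] -/
theorem subset_cl (U : Finset V) : U ⊆ cl G U :=
  @subset_closureOf V _ _ (IsClosed G) (fun W => Classical.dec (IsClosed G W)) U

/-- `cl(U)` is closed. [cite: ConnerydGhannanePang2025, Def. 6.6] -/
theorem isClosed_cl (U : Finset V) : IsClosed G (cl G U) :=
  @isClosed_closureOf V _ _ (IsClosed G) (fun W => Classical.dec (IsClosed G W)) isClosed_univ
    (fun _ _ hA hB => hA.inter hB) U

/-- `cl(U)` is the least closed superset. [cite: ConnerydGhannanePang2025, Def. 6.6] -/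
theorem cl_subset {U W : Finset V} (hUW : U ⊆ W) (hW : IsClosed G W) : cl G U ⊆ W :=
  @closureOf_subset V _ _ (IsClosed G) (fun W => Classical.dec (IsClosed G W)) U W hUW hW

/-- Monotonicity of `cl`. [cite: ConnerydGhannanePang2025, Def. 4.1 (monotonicity)] -/
theorem cl_mono {U U' : Finset V} (h : U ⊆ U') : cl G U ⊆ cl G U' :=
  cl_subset (h.trans (subset_cl U')) (isClosed_cl U')

/-- Idempotence of `cl`. [cite: ConnerydGhannanePang2025, Def. 4.1 (idempotence)] -/
theorem cl_cl (U : Finset V) : cl G (cl G U) = cl G U :=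
  Finset.Subset.antisymm (cl_subset Finset.Subset.rfl (isClosed_cl U)) (subset_cl _)

/-- Uniqueness of closures: every minimal closed superset of `U` is `cl(U)`.
[cite: ConnerydGhannanePang2025, Def. 6.6] -/
theorem eq_cl_of_minimal {U W : Finset V} (hUW : U ⊆ W) (hW : IsClosed G W)
    (hmin : ∀ W', U ⊆ W' → IsClosed G W' → W' ⊆ W → W' = W) : W = cl G U :=
  (hmin _ (subset_cl U) (isClosed_cl U) (cl_subset hUW hW)).symm

/-- The instance of monotonicity consumed by `graphCohomologicallyKConsistent_of_reducible`:
`cl(U ∖ a) ⊆ cl(U)`. [folklore] -/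
theorem cl_erase_subset (U : Finset V) (a : V) : cl G (U.erase a) ⊆ cl G U :=
  cl_mono (Finset.erase_subset a U)

end Closure

end Graph

end ConnerydGhannanePang

end Literature.ModelTheory.FiniteModelTheory
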